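import Summits.BirchSwinnertonDyer.BirchSwinnertonDyer.Theorems.EdixhovenFibreFiveSevenStarredOptimalManinUnitFiveSevenHcorTwoPow
import Literature.NumberTheory.Automorphic.UnboundedDenominatorsOfCor453
import Literature.NumberTheory.Automorphic.GaloisConjugateModularForms
import HarnessLib

set_option autoImplicit false
-- the sub-problem namespace `Summit.BirchSwinnertonDyer.BirchSwinnertonDyer` duplicates a component by design (D-0017)
set_option linter.dupNamespace false

/-!
# The Unbounded Denominators theorem with ALGEBRAIC-INTEGER coefficients (CDT Remarks 58–59) as a tree theorem

The statement-only (cite-only) Literature fact `CalegariDimitrovTang2025_unboundedDenominators_algInt` — an algebraic-integer-coefficient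
modular form for a finite-index subgroup of `SL₂(ℤ)` is modular for a congruence subgroup [CalegariDimitrovTang2025, Thm. 1.0.1 with
Remarks 58–59] — is the hypothesis of the closed Manin-side bundles `ManinSideOfCDT` (route TeichmullerTwistDescent,
stmt-BirchSwinnertonDyer-32257) and `TprimeManinSideOfCDT` (route TameQuarticManinParity, stmt-BirchSwinnertonDyer-32488), and a
cite-only dependency of both routes' cones.  It is now PROVED, by two pieces already in the tree:

* Voight's reduction `CalegariDimitrovTang2025_unboundedDenominators_algInt.of_unboundedDenominators : CDT → CDT_algInt`
  (`Literature/NumberTheory/Automorphic/GaloisConjugateModularForms.lean`: one number field carries all coefficients; Galois conjugates of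
  a modular form for a finite-index subgroup through the modular function `λ`);
* the Unbounded Denominators theorem itself, here as the term `of_cor453_invariant HcorTwoPow.stub_hcor_invariant_all` (CDT Cor. 4.5.3 in
  invariant form for all levels, line `cdt_thm1` of crux K★ stmt-BirchSwinnertonDyer-22226) — definitionally the tree's
  `calegariDimitrovTang2025_unboundedDenominators_holds` (p826028), taken from route-independent modules so that this discharge imports no
  route file.

DEPENDENCY / WORDING OF RECORD (director-bsd (848)(C), (849)(1)(4)).  The proof term IS the in-tree UDC term
(`calegariDimitrovTang2025_unboundedDenominators_holds`, unfolded) composed with Voight's reduction — UDC-dependent; audit (P†) pending;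
«kernel-closed (UDC-dependent, audit pending)», never «unconditional».  AS-TYPED vs PRINT: «=» print (Remarks 58–59 of the source; the
typed holomorphic-at-the-cusps case is weaker than print).  BSD is not proved by this; nothing here is an announcement.
[cite: CalegariDimitrovTang2025, Thm. 1.0.1, Cor. 4.5.3, Remarks 58–59]
-/

namespace Summit.BirchSwinnertonDyer.BirchSwinnertonDyer.Theorems

open Literature.NumberTheory.Automorphic Literature.NumberTheory.Automorphic.UnboundedDenominators

/-- **CDT Theorem 1.0.1 with algebraic-integer coefficients (Remarks 58–59) holds** (the Literature named fact
`CalegariDimitrovTang2025_unboundedDenominators_algInt`): Voight's reduction `…_algInt.of_unboundedDenominators` applied to the in-tree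
Unbounded Denominators term (Cor. 4.5.3 in invariant form, `HcorTwoPow.stub_hcor_invariant_all`, through `of_cor453_invariant`).
UDC-dependent; audit (P†) pending. [cite: CalegariDimitrovTang2025, Thm. 1.0.1 and Remarks 58–59] -/
theorem calegariDimitrovTang2025_unboundedDenominators_algInt_holds : CalegariDimitrovTang2025_unboundedDenominators_algInt :=
  CalegariDimitrovTang2025_unboundedDenominators_algInt.of_unboundedDenominators
    (CalegariDimitrovTang2025_unboundedDenominators.of_cor453_invariant HcorTwoPow.stub_hcor_invariant_all)

end Summit.BirchSwinnertonDyer.BirchSwinnertonDyer.Theorems
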